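import Literature.Probability.LatticeModels.DobrushinShlosmanUniqueness
import Literature.MathematicalPhysics.QuantumFieldTheory.Balaban1983to89.StrongCouplingDobrushinWindow
import Literature.MathematicalPhysics.QuantumLattice.LatticeGaugeDLRBoxKernels
import HarnessLib

/-!
# Venture YMGap — track (c) «DS»: the vertex-star window door IN INFINITE VOLUME —
# a star window bound on `ℤ^d` gives uniqueness of the `SU(N)` lattice Yang–Mills DLR state

HONEST FRAMING: venture file (cell `pub-ymgap`, PLAN R101/R102), strong-coupling LATTICE statement;
nothing about the continuum, confinement at weak coupling, or the mass gap. This file is a DOOR: it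
TYPES the `ℤ^d` analogue `StarWindowBoundZd` of the cell's torus hypothesis schema
`DSWindow.StarWindowBound` (vertex-star windows, per-star received sum `≤ ρ`) for the infinite-volume
Wilson specification `ymSpecification (fundamentalRep (Fin N)) β` of the tree, and PROVES

  `StarWindowBoundZd d N β ρ suFrobDist → ρ < 1 → HasUniqueGibbsMeasure (ymSpecification (fundamentalRep (Fin N)) β)`

(`hasUniqueGibbsMeasure_of_starWindowBoundZd`; `SU(2)`, `d = 4`, Wilson units:
`su2_hasUniqueGibbsMeasure_of_starWindowBoundZd`, conclusion literally the uniqueness clause of the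
tree's SC-a currency `DLRMassGapAt 4 2 (β_W/4)`). The door is the tree's Dobrushin–Shlosman uniqueness
theorem in infinite volume (`DobrushinShlosman.subsingleton_gibbsMeasures_of_window`, Vasserstein form,
arbitrary index set) fed with: the quasilocality of the Yang–Mills kernels
(`dependsOn_integral_ymSpecification`), the star geometry of `ℤ^d` (at most `2d` stars through a link;
exhaustion of `ℤ^d` by boxes of links with the profile `⌊(M − ‖x‖_∞)/3⌋`), existence of a DLR state by
compactness (`ymGibbsMeasures_nonempty`), and the Frobenius-coordinate closing step of the single-link
door (`suEntries`). NOTHING is asserted about the hypothesis: the cell's Lemma G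
(`starWindowBound_lemmaG`, torus, `β_W ≤ 1/2`, received sum `R_G(β_W) = 6c(1+c)/(1−4c−6c²)`, `c = β_W/4`)
is a TORUS statement; its `ℤ^4` counterpart (same local computation, or a torus → `ℤ^4` transfer of the
star kernels) is what turns this door into the unconditional row «infinite-volume DLR uniqueness for
`SU(2)`, `d = 4`, at every `β_W ≤ 9/25`» (PLAN R101: until then that clause is class A, App. S).

## Contents
* `vertexStarZd s` (the `2d` links of `ℤ^d` at the vertex `s`), `starWinZd c = vertexStarZd c.1`,
  `starNbhdZd s` (the star together with the links of the plaquettes touching it = the locality set of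
  the star kernel), membership lemmas, `card_filter_mem_starWinZd_le` (`≤ 2d` stars through a link);
* `supNormZd` (sup-norm of a site, in `ℕ`) and the coordinate bounds `≤ 1` on a star, `≤ 2` on its
  locality set;
* `exists_starExhaustion` — the exhaustion hypothesis of the abstract door for the star windows;
* `StarWindowBoundZd d N β ρ r` — the hypothesis schema (array `K(s; y → x) ≥ 0` supported in
  `starNbhdZd s`, (H1) for the star kernels of `ymSpecification (fundamentalRep (Fin N)) β` over the whole
  exterior field space, per-star received sum `≤ ρ`);
* `hasUniqueGibbsMeasure_of_starWindowBoundZd`, `su2_hasUniqueGibbsMeasure_of_starWindowBoundZd`.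

References: R. L. Dobrushin, S. B. Shlosman (1985), Thm. 1; H.-O. Georgii (2011) Thm. 8.7, (2.15);
cell files `LEAN-KROW.md`, `DS-AS-PRINTED.md` §6 (ds-1), `B4-BLUEPRINT.md` (ds-4).
-/

noncomputable section

open MeasureTheory ProbabilityTheory Function Finset
open Literature.Probability.LatticeModels
open Literature.Probability.LatticeModels.DobrushinMetric (IsLipBound)
open Literature.MathematicalPhysics.QuantumLattice
open Literature.MathematicalPhysics.QuantumFieldTheory (suFrobDist suFrobDist_nonneg suFrobDist_le suEntries
  dist_suEntries_le_suFrobDist measurableSpace_specialUnitaryGroup_eq_comap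
  isSpecification_ymSpecification_of_t2Space ymGibbsMeasures_nonempty)

namespace Summit.Ventures.YMGap.DSWindowZd

variable {d : ℕ}

/-! ### Vertex stars of `ℤ^d` and their locality sets -/

/-- The **vertex star** of the site `s` of `ℤ^d`: the `2d` positively oriented links with an endpoint at
`s` — the outgoing links `(s, μ)` and the incoming links `(s − e_μ, μ)`. -/
def vertexStarZd (s : Site d) : Finset (ZdEdge d) :=
  Finset.univ.image (fun μ : Fin d => ((s, μ) : ZdEdge d)) ∪
    Finset.univ.image (fun μ : Fin d => ((s - Pi.single μ 1, μ) : ZdEdge d))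

/-- Membership in a vertex star: `x ∈ vertexStarZd s` iff `s` is the initial point `x.1` or the end
point `x.1 + e_{x.2}` of the link `x`. -/
theorem mem_vertexStarZd {s : Site d} {x : ZdEdge d} :
    x ∈ vertexStarZd s ↔ s = x.1 ∨ s = x.1 + Pi.single x.2 1 := by
  constructor
  · intro h
    rcases Finset.mem_union.1 h with h | h
    · obtain ⟨μ, -, rfl⟩ := Finset.mem_image.1 h
      exact Or.inl rfl
    · obtain ⟨μ, -, rfl⟩ := Finset.mem_image.1 h
      exact Or.inr (by simp)
  · rintro (h | h)
    · exact Finset.mem_union_left _ (Finset.mem_image.2 ⟨x.2, Finset.mem_univ _, by rw [h]⟩)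
    · refine Finset.mem_union_right _ (Finset.mem_image.2 ⟨x.2, Finset.mem_univ _, ?_⟩)
      rw [h, add_sub_cancel_right]

/-- A link lies in the star of its initial point. -/
theorem self_mem_vertexStarZd (x : ZdEdge d) : x ∈ vertexStarZd x.1 :=
  mem_vertexStarZd.2 (Or.inl rfl)

/-- The **star window system** of `ℤ^d`: the window of the centre (link) `c` is the vertex star of its
initial point. -/
def starWinZd (c : ZdEdge d) : Finset (ZdEdge d) := vertexStarZd c.1

/-- Every link lies in its own star window. -/
theorem self_mem_starWinZd (c : ZdEdge d) : c ∈ starWinZd c := self_mem_vertexStarZd c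

/-- Membership in a star window. -/
theorem mem_starWinZd {c x : ZdEdge d} : x ∈ starWinZd c ↔ c.1 = x.1 ∨ c.1 = x.1 + Pi.single x.2 1 :=
  mem_vertexStarZd

/-- The **locality set of a vertex star**: the star together with the links of all plaquettes touching it
(the support of the boundary Wilson action of the star, `dependsOn_integral_ymSpecification`). -/
def starNbhdZd (s : Site d) : Finset (ZdEdge d) :=
  vertexStarZd s ∪ (plaquettesTouching (vertexStarZd s)).biUnion plaquetteEdges

/-- The star lies in its locality set. -/
theorem vertexStarZd_subset_starNbhdZd (s : Site d) : vertexStarZd s ⊆ starNbhdZd s :=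
  Finset.subset_union_left

/-- **At most `2d` star windows contain a given link**: the centres `c` with `x ∈ starWinZd c` have
initial point `x.1` or `x.1 + e_{x.2}`. -/
theorem card_filter_mem_starWinZd_le [DecidableEq (ZdEdge d)] (x : ZdEdge d) (G : Finset (ZdEdge d)) :
    (G.filter fun c => x ∈ starWinZd c).card ≤ 2 * d := by
  classical
  have hsub : (G.filter fun c => x ∈ starWinZd c) ⊆
      ({x.1, x.1 + Pi.single x.2 1} : Finset (Site d)) ×ˢ (Finset.univ : Finset (Fin d)) := by
    intro c hc
    have h := mem_starWinZd.1 (Finset.mem_filter.1 hc).2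
    refine Finset.mem_product.2 ⟨?_, Finset.mem_univ _⟩
    rcases h with h | h
    · exact Finset.mem_insert.2 (Or.inl h)
    · exact Finset.mem_insert.2 (Or.inr (Finset.mem_singleton.2 h))
  refine (Finset.card_le_card hsub).trans ?_
  rw [Finset.card_product, Finset.card_univ, Fintype.card_fin]
  exact Nat.mul_le_mul_right _ (Finset.card_le_two)

/-! ### Sup-norm bookkeeping on `ℤ^d` -/

/-- The sup-norm of a site of `ℤ^d`, as a natural number: `max_i |a i|`. -/
def supNormZd (a : Site d) : ℕ := Finset.univ.sup fun i => (a i).natAbs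

/-- `‖a‖_∞ ≤ n` iff every coordinate has absolute value `≤ n`. -/
theorem supNormZd_le_iff {a : Site d} {n : ℕ} : supNormZd a ≤ n ↔ ∀ i, (a i).natAbs ≤ n := by
  simp [supNormZd, Finset.sup_le_iff]

/-- Every coordinate is bounded by the sup-norm. -/
theorem natAbs_le_supNormZd (a : Site d) (i : Fin d) : (a i).natAbs ≤ supNormZd a :=
  Finset.le_sup (f := fun i => (a i).natAbs) (Finset.mem_univ i)

/-- **Triangle inequality in coordinates**: if every coordinate of `a − b` is at most `D` in absolute
value then `‖a‖_∞ ≤ ‖b‖_∞ + D`. -/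
theorem supNormZd_le_add {a b : Site d} {D : ℕ} (h : ∀ i, (a i - b i).natAbs ≤ D) :
    supNormZd a ≤ supNormZd b + D := by
  refine supNormZd_le_iff.2 fun i => ?_
  have h1 := h i
  have h2 := natAbs_le_supNormZd b i
  omega

/-- Links of a vertex star have initial point within sup-distance `1` of the vertex. -/
theorem natAbs_sub_le_one_of_mem_vertexStarZd {s : Site d} {x : ZdEdge d} (hx : x ∈ vertexStarZd s)
    (i : Fin d) : (x.1 i - s i).natAbs ≤ 1 := by
  rcases mem_vertexStarZd.1 hx with h | h
  · rw [h]; simp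
  · rw [h, Pi.add_apply, Pi.single_apply]
    split_ifs <;> simp

/-- Links of the locality set of a vertex star have initial point within sup-distance `2` of the vertex
(the Wilson interaction has range one: `exists_near_of_mem_collar`). -/
theorem natAbs_sub_le_two_of_mem_starNbhdZd {s : Site d} {y : ZdEdge d} (hy : y ∈ starNbhdZd s)
    (i : Fin d) : (y.1 i - s i).natAbs ≤ 2 := by
  rcases Finset.mem_union.1 hy with h | h
  · exact (natAbs_sub_le_one_of_mem_vertexStarZd h i).trans (by norm_num)
  · obtain ⟨e', he', hnear⟩ := exists_near_of_mem_collar h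
    have h1 := natAbs_sub_le_one_of_mem_vertexStarZd he' i
    have h2 := hnear i
    omega

/-! ### The exhaustion of `ℤ^d` by boxes of links, with the star profile -/

/-- **Exhaustion for the star windows.** For every finite set of links `Δ` and depth `L₀` there are a
finite set of links `Λ ⊇ Δ` and a profile `ℓ` (namely: all links based in a large box, and
`ℓ x = ⌊(M − ‖x.1‖_∞)/3⌋`) such that every star containing a link of positive profile has its centre and
its locality set inside `Λ`, the profile drops by at most one from a link of a star to a link of the star's
locality set, and `ℓ ≥ L₀` on `Δ` — the hypothesis `hexh` of
`DobrushinShlosman.subsingleton_gibbsMeasures_of_window` for any array supported in the locality sets. -/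
theorem exists_starExhaustion (K : Site d → ZdEdge d → ZdEdge d → ℝ)
    (hKsupp : ∀ s y x, K s y x ≠ 0 → y ∈ starNbhdZd s) (Δ : Finset (ZdEdge d)) (L₀ : ℕ) :
    ∃ (Λ : Finset (ZdEdge d)) (ℓ : ZdEdge d → ℕ), Δ ⊆ Λ ∧
      (∀ x, ℓ x ≠ 0 → ∀ c, x ∈ starWinZd c → c ∈ Λ ∧ starNbhdZd c.1 ⊆ Λ) ∧
      (∀ c x y, x ∈ starWinZd c → K c.1 y x ≠ 0 → ℓ x ≤ ℓ y + 1) ∧ (∀ x ∈ Δ, L₀ ≤ ℓ x) := by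
  classical
  -- radii
  set B : ℕ := Δ.sup fun x => supNormZd x.1 with hB
  set M : ℕ := B + 3 * L₀ + 3 with hM
  refine ⟨(box d (M + 3)) ×ˢ (Finset.univ : Finset (Fin d)), fun x => (M - supNormZd x.1) / 3,
    ?_, ?_, ?_, ?_⟩
  · -- `Δ ⊆ Λ`
    intro x hx
    have hxB : supNormZd x.1 ≤ B := Finset.le_sup (f := fun x : ZdEdge d => supNormZd x.1) hx
    refine Finset.mem_product.2 ⟨mem_box.2 fun i => ?_, Finset.mem_univ _⟩
    have h := natAbs_le_supNormZd x.1 i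
    omega
  · -- stars around links of positive profile lie inside `Λ` with their locality sets
    intro x hx c hxc
    have hxM : supNormZd x.1 + 3 ≤ M := by
      by_contra h
      exact hx (Nat.div_eq_of_lt (by omega))
    have hcx : supNormZd c.1 ≤ supNormZd x.1 + 1 := by
      refine supNormZd_le_add fun i => ?_
      have h := natAbs_sub_le_one_of_mem_vertexStarZd hxc i
      rwa [← Int.natAbs_neg, neg_sub] at h
    refine ⟨Finset.mem_product.2 ⟨mem_box.2 fun i => ?_, Finset.mem_univ _⟩, fun y hy => ?_⟩
    · have h := natAbs_le_supNormZd c.1 i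
      omega
    · have hyc : supNormZd y.1 ≤ supNormZd c.1 + 2 :=
        supNormZd_le_add fun i => natAbs_sub_le_two_of_mem_starNbhdZd hy i
      refine Finset.mem_product.2 ⟨mem_box.2 fun i => ?_, Finset.mem_univ _⟩
      have h := natAbs_le_supNormZd y.1 i
      omega
  · -- the profile drops by at most one along the support of the array
    intro c x y hxc hK
    have hy : y ∈ starNbhdZd c.1 := hKsupp _ _ _ hK
    have hyx : supNormZd y.1 ≤ supNormZd x.1 + 3 := by
      refine supNormZd_le_add fun i => ?_
      have h1 := natAbs_sub_le_one_of_mem_vertexStarZd hxc i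
      have h2 := natAbs_sub_le_two_of_mem_starNbhdZd hy i
      omega
    show (M - supNormZd x.1) / 3 ≤ (M - supNormZd y.1) / 3 + 1
    omega
  · -- `ℓ ≥ L₀` on `Δ`
    intro x hx
    have hxB : supNormZd x.1 ≤ B := Finset.le_sup (f := fun x : ZdEdge d => supNormZd x.1) hx
    show L₀ ≤ (M - supNormZd x.1) / 3
    rw [Nat.le_div_iff_mul_le (by norm_num)]
    omega

/-! ### The hypothesis schema and the door -/

variable (d) in
/-- **The star window bound on `ℤ^d` for `SU(N)` lattice Yang–Mills at bare coupling `β` with received sum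
`≤ ρ`** — the `ℤ^d` analogue of the cell's torus schema `DSWindow.StarWindowBound` (same shape, the torus
replaced by the infinite lattice and the torus weight specification by the tree's
`ymSpecification (fundamentalRep (Fin N)) β`), for a group weight `r` on `SU(N)`: there is a vertex-indexed
array `K(s; y → x) ≥ 0`, supported on links `y` of the locality set `starNbhdZd s`, such that (H1) for every
centre `c`, every link `y` outside its star, all exterior fields `ω = η` off `y`, and every bounded
measurable star-local `f` with site-Lipschitz vector `δ ≥ 0`,
`|γ_⋆ f(ω) − γ_⋆ f(η)| ≤ (Σ_{x ∈ ⋆} K(c.1; y → x) δ x) · r(ω_y, η_y)`, and (H2) the per-star received sum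
`Σ_{y} K(s; y → x) ≤ ρ` for every `x ∈ vertexStarZd s`. A `Prop`; never asserted here (the cell's Lemma G
computes `ρ = R_G(β_W)` for `SU(2)`, `d = 4` ON THE TORUS; the `ℤ^4` version is its open counterpart). -/
def StarWindowBoundZd (N : ℕ) (β ρ : ℝ)
    (r : Matrix.specialUnitaryGroup (Fin N) ℂ → Matrix.specialUnitaryGroup (Fin N) ℂ → ℝ) : Prop :=
  ∃ K : Site d → ZdEdge d → ZdEdge d → ℝ,
    (∀ s y x, 0 ≤ K s y x) ∧ (∀ s y x, K s y x ≠ 0 → y ∈ starNbhdZd s) ∧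
    (∀ (c y : ZdEdge d), y ∉ starWinZd c →
      ∀ (ω η : LGConfig d (Matrix.specialUnitaryGroup (Fin N) ℂ)), (∀ v, v ≠ y → ω v = η v) →
      ∀ (f : LGConfig d (Matrix.specialUnitaryGroup (Fin N) ℂ) → ℝ) (δ : ZdEdge d → ℝ),
        Measurable f → (∃ B, ∀ σ, |f σ| ≤ B) → DependsOn f (starWinZd c : Set (ZdEdge d)) →
        (∀ x, 0 ≤ δ x) →
        (∀ (x : ZdEdge d) (σ τ : LGConfig d (Matrix.specialUnitaryGroup (Fin N) ℂ)),
          (∀ v, v ≠ x → σ v = τ v) → |f σ - f τ| ≤ δ x * r (σ x) (τ x)) →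
          |∫ σ, f σ ∂(ymSpecification (d := d) (fundamentalRep (Fin N)) β (starWinZd c) ω) -
              ∫ σ, f σ ∂(ymSpecification (d := d) (fundamentalRep (Fin N)) β (starWinZd c) η)| ≤
            (∑ x ∈ starWinZd c, K c.1 y x * δ x) * r (ω y) (η y)) ∧
    ∀ (s : Site d) (x : ZdEdge d), x ∈ vertexStarZd s → ∑ y ∈ starNbhdZd s, K s y x ≤ ρ

/-- **THE STAR DOOR IN INFINITE VOLUME.** For `SU(N)` lattice Yang–Mills on `ℤ^d` at bare coupling `β`
(`ymSpecification (fundamentalRep (Fin N)) β`), the star window bound with received sum `ρ < 1` for the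
Frobenius weight `suFrobDist` implies that the infinite-volume DLR state is UNIQUE
(`HasUniqueGibbsMeasure`: at most one by the tree's Dobrushin–Shlosman uniqueness theorem in infinite
volume, `DobrushinShlosman.subsingleton_gibbsMeasures_of_window`, fed with the quasilocality of the
Wilson kernels, the star geometry and the box exhaustion of `ℤ^d`; at least one by compactness,
`ymGibbsMeasures_nonempty`). Nothing is asserted about the hypothesis. -/
theorem hasUniqueGibbsMeasure_of_starWindowBoundZd {N : ℕ} (β : ℝ) {ρ : ℝ} (hρ0 : 0 ≤ ρ) (hρ1 : ρ < 1)
    (h : StarWindowBoundZd d N β ρ suFrobDist) :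
    HasUniqueGibbsMeasure (ymSpecification (d := d) (fundamentalRep (Fin N)) β) := by
  classical
  -- `SU(N) ⊆ M_N(ℂ)` is second countable
  haveI : SecondCountableTopology (Matrix (Fin N) (Fin N) ℂ) :=
    inferInstanceAs (SecondCountableTopology (Fin N → Fin N → ℂ))
  haveI : SecondCountableTopology (Matrix.specialUnitaryGroup (Fin N) ℂ) :=
    Topology.IsEmbedding.subtypeVal.secondCountableTopology
  obtain ⟨K, hK0, hKsupp, hcontract, hsum⟩ := h
  have hγ : IsSpecification (ymSpecification (d := d) (fundamentalRep (Fin N)) β) :=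
    isSpecification_ymSpecification_of_t2Space _ (continuous_fundamentalRep (Fin N)) _
  have hR₀ : (0 : ℝ) ≤ 2 * Real.sqrt N := by positivity
  have hA : ∀ a b : Matrix.specialUnitaryGroup (Fin N) ℂ,
      dist (suEntries a) (suEntries b) ≤ 1 * suFrobDist a b := fun a b => by
    rw [one_mul]; exact dist_suEntries_le_suFrobDist a b
  -- locality of the star kernels (finite range of the Wilson interaction)
  have hloc : ∀ (c : ZdEdge d) (ζ ζ' : LGConfig d (Matrix.specialUnitaryGroup (Fin N) ℂ)),
      (∀ v ∈ starNbhdZd c.1, ζ v = ζ' v) →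
      ∀ (f : LGConfig d (Matrix.specialUnitaryGroup (Fin N) ℂ) → ℝ), Measurable f →
        (∃ B, ∀ σ, |f σ| ≤ B) → DependsOn f (starWinZd c : Set (ZdEdge d)) →
        ∫ σ, f σ ∂(ymSpecification (d := d) (fundamentalRep (Fin N)) β (starWinZd c) ζ) =
          ∫ σ, f σ ∂(ymSpecification (d := d) (fundamentalRep (Fin N)) β (starWinZd c) ζ') := by
    intro c ζ ζ' hζ f hfm _ hfdep
    exact dependsOn_integral_ymSpecification (fundamentalRep (Fin N)) (continuous_fundamentalRep (Fin N))
      β (starWinZd c) hfm hfdep fun v hv => hζ v (Finset.mem_coe.1 hv)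
  refine ⟨?_, ymGibbsMeasures_nonempty (d := d) (fundamentalRep (Fin N))
    (continuous_fundamentalRep (Fin N)) β⟩
  exact DobrushinShlosman.subsingleton_gibbsMeasures_of_window hγ suFrobDist_nonneg suFrobDist_le hR₀
    (win := starWinZd) (nbhd := fun c => starNbhdZd c.1) (K := fun c => K c.1) (fun c y x => hK0 _ _ _)
    self_mem_starWinZd (fun c => vertexStarZd_subset_starNbhdZd c.1) (fun c y x => hKsupp _ _ _)
    hcontract hloc hρ0 hρ1 (fun c x hx => hsum c.1 x hx) (Nstar := 2 * d)
    card_filter_mem_starWinZd_le (exists_starExhaustion K hKsupp) suEntries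
    measurableSpace_specialUnitaryGroup_eq_comap zero_le_one hA

/-- **`SU(2)`, `d = 4`, Wilson units** (`β_W = 4/g²`, 't Hooft coupling `β_W/4`, bare tree coupling
`2 · (β_W/4) = β_W/2`): the star window bound on `ℤ^4` with received sum `ρ < 1` gives uniqueness of the
infinite-volume `SU(2)` DLR state — literally the uniqueness clause of the tree's SC-a currency
`DLRMassGapAt 4 2 (β_W/4)`. With the cell's received sum `ρ = R_G(β_W) < 1` for `β_W ≤ 9/25` this is the
K-form of PLAN R101's «infinite-volume DLR uniqueness» clause, CONDITIONAL on the `ℤ^4` star bound. -/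
theorem su2_hasUniqueGibbsMeasure_of_starWindowBoundZd (βW : ℝ) {ρ : ℝ} (hρ0 : 0 ≤ ρ) (hρ1 : ρ < 1)
    (h : StarWindowBoundZd 4 2 ((2 : ℕ) * (βW / 4)) ρ suFrobDist) :
    HasUniqueGibbsMeasure (ymSpecification (d := 4) (fundamentalRep (Fin 2)) ((2 : ℕ) * (βW / 4))) :=
  hasUniqueGibbsMeasure_of_starWindowBoundZd _ hρ0 hρ1 h

end Summit.Ventures.YMGap.DSWindowZd

end
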